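import Summits.BirchSwinnertonDyer.BirchSwinnertonDyer.Theorems.AdditiveKolyvaginRoadLevelKolyvaginSystemsAdditiveTwinDrop
import Summits.BirchSwinnertonDyer.BirchSwinnertonDyer.Theorems.AdditiveKolyvaginRoadKolyvaginIsoBound
import HarnessLib

/-!
# Route `AdditiveKolyvaginRoad`, crux KS′ `LevelKolyvaginSystemsAdditive` (item stmt-BirchSwinnertonDyer-21396):
# the TWIN DICHOTOMY for the mixed Selmer spaces, RISE HALF (Howard 2004 Lemma 2.5.3 (b), given a detected transverse class)
# — in the kernel, from Tate reciprocity and the local line-rigidity (IsoBound)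
# (cell `pub/bsd-wall`, width seat `bsd-wall-akr-p2x-w2` g6; `--supports stmt-BirchSwinnertonDyer-21396`, helper; discharges the binder `hRise`
# of `nonempty_levelKolyvaginSystemP_of_seed_of_twin`; after `…TwinDrop`)

WHY. (Twin) for the mixed spaces `Sel(m, n)^μ` = three binders `hDrop`, `hRise`, `hJump` of `nonempty_levelKolyvaginSystemP_of_seed_of_twin`
(p625738). `…TwinDrop` proved `hDrop`. THIS FILE proves `hRise`: if some class of `Sel(mℓ, n)^μ` (transverse at the place `λ` of the Kolyvagin
prime `ℓ ∉ m`) is DETECTED at `λ`, then `Sel(m, n)^μ` is exactly the part of `Sel(mℓ, n)^μ` locally trivial at `λ`, of codimension one.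
* `weilCupProduct_eq_zero_at_of_mixedRelaxed` — the `λ`-relaxed mixed structure is isotropic AT `λ` (Tate reciprocity for the totally complex `K`,
  tree `Iso.weilCupProduct_localization_eq_zero_of_forall_ne`, fed with `…TwinDrop`'s vanishing away from `λ`).
* `twinRise_mixed` — THE RESULT, literally the `hRise` binder: no Kummer `μ`-class is detected at `λ` ((Perf) against reciprocity); the memberships
  differ only at `λ`; the localisations of the `μ`-eigenclasses of `Sel(mℓ, n)^μ` lie on the line through the detected one by (IsoBound)
  `sub_zsmul_mem_torsionLocalKer_of_isotropic_P` (isotropy from reciprocity) — rank–nullity in the `torsionLocMap` model.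

WHAT REMAINS of (Twin): `hJump` alone — «at a non-empty level, one of `Sel(m, n)^μ`, `Sel(mℓ, n)^μ` has a class detected at `λ`» = the
Poitou–Tate jump for the relaxed structure (tree `hjump_of_poitouTateP`, giving a detected `μ`-eigenclass of the RELAXED structure via the
eigen-decomposition and (IsoBound), as in `supply_signed_of_jumpP`) + the local trichotomy «such a class is Kummer or transverse at `λ`».

HONEST FRAMING: theorems only; 0 definitions, 0 named facts, 0 `sorry`; no Poitou–Tate fact used. Closes nothing by itself. BSD is not proved by
any of this; KS′ is OPEN.

References: [cite: Howard2004HeegnerKolyvagin, Lemma 2.5.3, Lemma 2.5.6] [cite: GrossLMS1991, Prop. 8.1, Prop. 8.2, Prop. 9.6]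
[cite: McCallumLMS1991, Lemma 5.3] [cite: WZhang2014, Lemma 8.4, §8.1] [cite: MilneADT2006, Ch. I, Thm. 4.10(b)].
-/

set_option linter.dupNamespace false -- single-conjunct summit repeats the name by design

noncomputable section

open scoped Classical

namespace Summit.BirchSwinnertonDyer.BirchSwinnertonDyer.Theorems.AdditiveKoly

open CategoryTheory WeierstrassCurve Field Function NumberField IsDedekindDomain
open Literature.NumberTheory.EllipticCurves Literature.NumberTheory.EllipticCurves.ModularForms
  Literature.NumberTheory.GaloisRepresentations Module
open Literature.NumberTheory.GaloisRepresentations.DiscreteGaloisModule (mu MuCarrier)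
open Literature.NumberTheory.GaloisCohomology
open Summit.BirchSwinnertonDyer.Rank1Residual.X11b.Three.Koly.Method2
open Summit.BirchSwinnertonDyer.Rank1Residual.X11b.Three.Koly
open scoped ContRepresentation

variable (W : WeierstrassCurve ℚ) (K : Type) [Field K] [NumberField K] (p : ℕ) [W.IsElliptic] [W.IsGloballyMinimal]
  [Fact p.Prime] (c : K ≃ₐ[ℚ] K) (ι : K →+* ℂ) [Module (ZMod p) (Vp W K p)]

/-! ## §4 (Twin), RISE half: a detected transverse class above `ℓ` at conductor `mℓ` makes the conductor-`m` space the strict part -/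

omit [Module (ZMod p) (Vp W K p)] in
/-- **The `λ`-relaxed mixed structure is isotropic AT `λ` too** (Poitou–Tate see-saw, isotropy half, for the mixed structure): for two classes
of the relaxed structure of §2 the local Weil cup product at the place `v` of `ℓ` vanishes (Tate reciprocity for the totally complex `K`, tree theorem
`Iso.weilCupProduct_localization_eq_zero_of_forall_ne`, fed with §2). [cite: Howard2004HeegnerKolyvagin, Lemma 2.5.6] [cite: MilneADT2006, Ch. I, Thm. 4.10(b)] -/
theorem weilCupProduct_eq_zero_at_of_mixedRelaxed [∀ w : Place K, CompactSpace (absoluteGaloisGroup (Place.Completion w))]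
    (hK : IsImaginaryQuadratic K) (hp2 : p ≠ 2)
    (e : geomTorsion (W.baseChange K) ((p ^ 1 : ℕ) : ℤ) → geomTorsion (W.baseChange K) ((p ^ 1 : ℕ) : ℤ) → AlgebraicClosure K)
    (hμ : ∀ P Q, e P Q ^ (p ^ 1) = 1) (hadd₁ : ∀ P₁ P₂ Q, e (P₁ + P₂) Q = e P₁ Q * e P₂ Q)
    (hadd₂ : ∀ P Q₁ Q₂, e P (Q₁ + Q₂) = e P Q₁ * e P Q₂) (halt : ∀ Q, e Q Q = 1)
    (hgal : ∀ (σ : absoluteGaloisGroup K) (P Q : geomTorsion (W.baseChange K) ((p ^ 1 : ℕ) : ℤ)), σ • e P Q = e (σ • P) (σ • Q))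
    (m : Finset {ℓ // Zhang2014.IsKolyvaginPrime (W.conductorNorm ℤ) W K p ℓ}) (ℓ : {ℓ // Zhang2014.IsKolyvaginPrime (W.conductorNorm ℤ) W K p ℓ}) (n : Finset (AdmQ W K p))
    (v : HeightOneSpectrum (𝓞 K)) (hv : ((ℓ : ℕ) : 𝓞 K) ∈ v.asIdeal) {y z : Vp W K p}
    (hy : ((∀ w : InfinitePlace K, y ∈ selmerLocalKer (W.baseChange K) w.Completion ((p ^ 1 : ℕ) : ℤ)) ∧
      (∀ w : HeightOneSpectrum (𝓞 K), ((ℓ : ℕ) : 𝓞 K) ∉ w.asIdeal → (∀ ℓ' ∈ m, ((ℓ' : ℕ) : 𝓞 K) ∉ w.asIdeal) →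
        (∀ q ∈ n, ((q : ℕ) : 𝓞 K) ∉ w.asIdeal) → y ∈ selmerLocalKer (W.baseChange K) (w.adicCompletion K) ((p ^ 1 : ℕ) : ℤ)) ∧
      (∀ q ∈ n, ∀ w : HeightOneSpectrum (𝓞 K), ((q : ℕ) : 𝓞 K) ∈ w.asIdeal →
        y ∈ toricLocalKer (W.baseChange K) (w.adicCompletion K) ((p ^ 1 : ℕ) : ℤ)) ∧
      (∀ ℓ' ∈ m, ∀ w : HeightOneSpectrum (𝓞 K), ((ℓ' : ℕ) : 𝓞 K) ∈ w.asIdeal → y ∈ transverseLocalKerP W K p ι ℓ' w)))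
    (hz : ((∀ w : InfinitePlace K, z ∈ selmerLocalKer (W.baseChange K) w.Completion ((p ^ 1 : ℕ) : ℤ)) ∧
      (∀ w : HeightOneSpectrum (𝓞 K), ((ℓ : ℕ) : 𝓞 K) ∉ w.asIdeal → (∀ ℓ' ∈ m, ((ℓ' : ℕ) : 𝓞 K) ∉ w.asIdeal) →
        (∀ q ∈ n, ((q : ℕ) : 𝓞 K) ∉ w.asIdeal) → z ∈ selmerLocalKer (W.baseChange K) (w.adicCompletion K) ((p ^ 1 : ℕ) : ℤ)) ∧
      (∀ q ∈ n, ∀ w : HeightOneSpectrum (𝓞 K), ((q : ℕ) : 𝓞 K) ∈ w.asIdeal →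
        z ∈ toricLocalKer (W.baseChange K) (w.adicCompletion K) ((p ^ 1 : ℕ) : ℤ)) ∧
      (∀ ℓ' ∈ m, ∀ w : HeightOneSpectrum (𝓞 K), ((ℓ' : ℕ) : 𝓞 K) ∈ w.asIdeal → z ∈ transverseLocalKerP W K p ι ℓ' w))) :
    (weilContPairingLocal (W.baseChange K) (p ^ 1) e hμ hadd₁ hadd₂ hgal (Sum.inr v)).cupProduct
        (galoisCohomology.localization ((W.baseChange K).torsionGaloisModule ((p ^ 1 : ℕ) : ℤ)) (Sum.inr v) 1 y)
        (galoisCohomology.localization ((W.baseChange K).torsionGaloisModule ((p ^ 1 : ℕ) : ℤ)) (Sum.inr v) 1 z) = 0 := by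
  have hp : p.Prime := Fact.out
  haveI : Fact (Nat.Prime (p ^ 1)) := ⟨by rw [pow_one]; exact hp⟩
  haveI : IsTotallyComplex K := hK.2
  -- the relaxed structure as a subgroup
  let R : AddSubgroup (Vp W K p) :=
    (⨅ w : InfinitePlace K, selmerLocalKer (W.baseChange K) w.Completion ((p ^ 1 : ℕ) : ℤ)) ⊓
    ((⨅ (w : HeightOneSpectrum (𝓞 K)) (_ : ((ℓ : ℕ) : 𝓞 K) ∉ w.asIdeal) (_ : ∀ ℓ' ∈ m, ((ℓ' : ℕ) : 𝓞 K) ∉ w.asIdeal)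
        (_ : ∀ q ∈ n, ((q : ℕ) : 𝓞 K) ∉ w.asIdeal), selmerLocalKer (W.baseChange K) (w.adicCompletion K) ((p ^ 1 : ℕ) : ℤ)) ⊓
     ((⨅ (q : AdmQ W K p) (_ : q ∈ n) (w : HeightOneSpectrum (𝓞 K)) (_ : ((q : ℕ) : 𝓞 K) ∈ w.asIdeal),
        toricLocalKer (W.baseChange K) (w.adicCompletion K) ((p ^ 1 : ℕ) : ℤ)) ⊓
      (⨅ (ℓ' : {ℓ // Zhang2014.IsKolyvaginPrime (W.conductorNorm ℤ) W K p ℓ}) (_ : ℓ' ∈ m) (w : HeightOneSpectrum (𝓞 K)) (_ : ((ℓ' : ℕ) : 𝓞 K) ∈ w.asIdeal),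
        transverseLocalKerP W K p ι ℓ' w)))
  have hR : ∀ x : Vp W K p, ((∀ w : InfinitePlace K, x ∈ selmerLocalKer (W.baseChange K) w.Completion ((p ^ 1 : ℕ) : ℤ)) ∧
      (∀ w : HeightOneSpectrum (𝓞 K), ((ℓ : ℕ) : 𝓞 K) ∉ w.asIdeal → (∀ ℓ' ∈ m, ((ℓ' : ℕ) : 𝓞 K) ∉ w.asIdeal) →
        (∀ q ∈ n, ((q : ℕ) : 𝓞 K) ∉ w.asIdeal) → x ∈ selmerLocalKer (W.baseChange K) (w.adicCompletion K) ((p ^ 1 : ℕ) : ℤ)) ∧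
      (∀ q ∈ n, ∀ w : HeightOneSpectrum (𝓞 K), ((q : ℕ) : 𝓞 K) ∈ w.asIdeal →
        x ∈ toricLocalKer (W.baseChange K) (w.adicCompletion K) ((p ^ 1 : ℕ) : ℤ)) ∧
      (∀ ℓ' ∈ m, ∀ w : HeightOneSpectrum (𝓞 K), ((ℓ' : ℕ) : 𝓞 K) ∈ w.asIdeal → x ∈ transverseLocalKerP W K p ι ℓ' w)) → x ∈ R := by
    rintro x ⟨h1, h2, h3, h4⟩
    change x ∈ _ ⊓ (_ ⊓ (_ ⊓ _))
    simp only [AddSubgroup.mem_inf, AddSubgroup.mem_iInf]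
    exact ⟨h1, h2, h3, h4⟩
  have hR' : ∀ x ∈ R, ((∀ w : InfinitePlace K, x ∈ selmerLocalKer (W.baseChange K) w.Completion ((p ^ 1 : ℕ) : ℤ)) ∧
      (∀ w : HeightOneSpectrum (𝓞 K), ((ℓ : ℕ) : 𝓞 K) ∉ w.asIdeal → (∀ ℓ' ∈ m, ((ℓ' : ℕ) : 𝓞 K) ∉ w.asIdeal) →
        (∀ q ∈ n, ((q : ℕ) : 𝓞 K) ∉ w.asIdeal) → x ∈ selmerLocalKer (W.baseChange K) (w.adicCompletion K) ((p ^ 1 : ℕ) : ℤ)) ∧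
      (∀ q ∈ n, ∀ w : HeightOneSpectrum (𝓞 K), ((q : ℕ) : 𝓞 K) ∈ w.asIdeal →
        x ∈ toricLocalKer (W.baseChange K) (w.adicCompletion K) ((p ^ 1 : ℕ) : ℤ)) ∧
      (∀ ℓ' ∈ m, ∀ w : HeightOneSpectrum (𝓞 K), ((ℓ' : ℕ) : 𝓞 K) ∈ w.asIdeal → x ∈ transverseLocalKerP W K p ι ℓ' w)) := by
    intro x hx
    change x ∈ _ ⊓ (_ ⊓ (_ ⊓ _)) at hx
    simp only [AddSubgroup.mem_inf, AddSubgroup.mem_iInf] at hx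
    exact hx
  exact Iso.weilCupProduct_localization_eq_zero_of_forall_ne (W.baseChange K) (p ^ 1) e hμ hadd₁ hadd₂ hgal v R
    (fun y hy z hz ↦ weilCupProduct_eq_zero_of_mixedRelaxed W K p ι hK hp2 e hμ hadd₁ hadd₂ halt hgal m ℓ n v hv (hR' y hy) (hR' z hz))
    (hR y hy) (hR z hz)

/-- **(Twin) RISE HALF for the mixed spaces — Howard 2004 Lemma 2.5.3 (b), given the jump.** Same frame and data as `twinDrop_mixed`. If some class
of `Sel(mℓ, n)^μ` (transverse at `λ`) is DETECTED above `ℓ`, then `Sel(m, n)^μ` is EXACTLY the part of `Sel(mℓ, n)^μ` locally trivial above `ℓ`, of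
codimension one: no Kummer class of sign `μ` is then detected at `λ` ((Perf) against reciprocity, as in the drop half); the memberships differ only
at `λ`; and the localisations of the `μ`-eigenclasses of the relaxed structure span an ISOTROPIC subspace (reciprocity), hence lie on the line through
the detected one by the local line-rigidity (IsoBound) `sub_zsmul_mem_torsionLocalKer_of_isotropic_P` (Gross Prop. 8.1 ∕ 9.6, McCallum Lemma 5.3)
— rank–nullity. The existence of a detected class on ONE side (the Poitou–Tate JUMP `hJump`) is NOT proved here.
[cite: Howard2004HeegnerKolyvagin, Lemma 2.5.3] [cite: WZhang2014, Lemma 8.4] [cite: GrossLMS1991, Prop. 8.1, Prop. 9.6] [cite: McCallumLMS1991, Lemma 5.3] -/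
theorem twinRise_mixed (hK : IsImaginaryQuadratic K) (hp2 : p ≠ 2) (hsurj : W.HasSurjectiveModNGaloisRep p) (hc1 : c ≠ 1)
    (Mix : Finset {ℓ // Zhang2014.IsKolyvaginPrime (W.conductorNorm ℤ) W K p ℓ} → Finset (AdmQ W K p) → Bool → Submodule (ZMod p) (Vp W K p))
    (hMix : ∀ (m : Finset {ℓ // Zhang2014.IsKolyvaginPrime (W.conductorNorm ℤ) W K p ℓ}) (n : Finset (AdmQ W K p)) (μ : Bool) (x : Vp W K p),
      x ∈ Mix m n μ ↔ (conjAct W c ((p ^ 1 : ℕ) : ℤ) x = sgnP μ • x ∧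
        (∀ w : InfinitePlace K, x ∈ selmerLocalKer (W.baseChange K) w.Completion ((p ^ 1 : ℕ) : ℤ)) ∧
        (∀ v : HeightOneSpectrum (𝓞 K), (∀ ℓ ∈ m, ((ℓ : ℕ) : 𝓞 K) ∉ v.asIdeal) → (∀ q ∈ n, ((q : ℕ) : 𝓞 K) ∉ v.asIdeal) →
          x ∈ selmerLocalKer (W.baseChange K) (v.adicCompletion K) ((p ^ 1 : ℕ) : ℤ)) ∧
        (∀ q ∈ n, ∀ v : HeightOneSpectrum (𝓞 K), ((q : ℕ) : 𝓞 K) ∈ v.asIdeal →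
          x ∈ toricLocalKer (W.baseChange K) (v.adicCompletion K) ((p ^ 1 : ℕ) : ℤ)) ∧
        (∀ ℓ ∈ m, ∀ v : HeightOneSpectrum (𝓞 K), ((ℓ : ℕ) : 𝓞 K) ∈ v.asIdeal → x ∈ transverseLocalKerP W K p ι ℓ v)))
    (hfin : ∀ (m : Finset {ℓ // Zhang2014.IsKolyvaginPrime (W.conductorNorm ℤ) W K p ℓ}) (n : Finset (AdmQ W K p)) (μ : Bool), Module.Finite (ZMod p) (Mix m n μ)) :
    ∀ (m : Finset {ℓ // Zhang2014.IsKolyvaginPrime (W.conductorNorm ℤ) W K p ℓ}) (ℓ : {ℓ // Zhang2014.IsKolyvaginPrime (W.conductorNorm ℤ) W K p ℓ}) (n : Finset (AdmQ W K p)) (μ : Bool), ℓ ∉ m → n.Nonempty →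
      (∃ y ∈ Mix (insert ℓ m) n μ, ¬ (∀ v : HeightOneSpectrum (𝓞 K), ((ℓ : ℕ) : 𝓞 K) ∈ v.asIdeal → y ∈ (W.baseChange K).torsionLocalKer (v.adicCompletion K) ((p ^ 1 : ℕ) : ℤ))) →
      (∀ x, x ∈ Mix m n μ ↔ (x ∈ Mix (insert ℓ m) n μ ∧ (∀ v : HeightOneSpectrum (𝓞 K), ((ℓ : ℕ) : 𝓞 K) ∈ v.asIdeal → x ∈ (W.baseChange K).torsionLocalKer (v.adicCompletion K) ((p ^ 1 : ℕ) : ℤ)))) ∧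
        finrank (ZMod p) (Mix m n μ) + 1 = finrank (ZMod p) (Mix (insert ℓ m) n μ) := by
  intro m ℓ n μ hℓm _ hdet
  have hp : p.Prime := Fact.out
  haveI : Fact (Nat.Prime (p ^ 1)) := ⟨by rw [pow_one]; exact hp⟩
  haveI : IsTotallyComplex K := hK.2
  haveI hcs : ∀ (L : Type) [Field L], CompactSpace (absoluteGaloisGroup L) := fun L _ ↦ @absoluteGaloisGroup_compactSpace L _
  haveI : ∀ w : Place K, CompactSpace (absoluteGaloisGroup (Place.Completion w)) := fun w ↦ absoluteGaloisGroup_compactSpace _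
  haveI : Finite (geomTorsion (W.baseChange K) ((p ^ 1 : ℕ) : ℤ)) := finite_geomTorsion_of_neZero (W.baseChange K) (p ^ 1)
  obtain ⟨e, hμ, hadd₁, hadd₂, halt, hnondeg, hgal⟩ :=
    exists_weilPairing_holds (W.baseChange K) (p ^ 1) (by rw [pow_one]; exact hp.two_le) (by
      rw [pow_one]; exact_mod_cast hp.ne_zero)
  -- the detected transverse class and the (unique) place above `ℓ`
  obtain ⟨y, hyB, hTy⟩ := hdet
  push Not at hTy
  obtain ⟨v, hv, hyv⟩ := hTy
  have huniq : ∀ w : HeightOneSpectrum (𝓞 K), ((ℓ : ℕ) : 𝓞 K) ∈ w.asIdeal → w = v :=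
    fun w hw ↦ placesAbove_eq_of_isPrime_span K ℓ.2.2.2.2.2.1 ℓ.2.1.ne_zero hv hw
  have hmv : ∀ ℓ' ∈ m, ((ℓ' : ℕ) : 𝓞 K) ∉ v.asIdeal := fun ℓ' hℓ' ↦
    not_natCast_mem_of_prime_ne (K := K) ℓ.2.1 ℓ'.2.1 (fun h ↦ hℓm (by rwa [show ℓ = ℓ' from Subtype.ext h])) v hv
  have hnv : ∀ q ∈ n, ((q : ℕ) : 𝓞 K) ∉ v.asIdeal := fun q _ ↦
    not_natCast_mem_of_prime_ne (K := K) ℓ.2.1 q.2.1 (kolyvaginPrime_ne_admQ W K p ℓ q) v hv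
  -- both mixed spaces lie in the relaxed structure
  have hrelA : ∀ x ∈ Mix m n μ, ((∀ w : InfinitePlace K, x ∈ selmerLocalKer (W.baseChange K) w.Completion ((p ^ 1 : ℕ) : ℤ)) ∧
      (∀ w : HeightOneSpectrum (𝓞 K), ((ℓ : ℕ) : 𝓞 K) ∉ w.asIdeal → (∀ ℓ' ∈ m, ((ℓ' : ℕ) : 𝓞 K) ∉ w.asIdeal) →
        (∀ q ∈ n, ((q : ℕ) : 𝓞 K) ∉ w.asIdeal) → x ∈ selmerLocalKer (W.baseChange K) (w.adicCompletion K) ((p ^ 1 : ℕ) : ℤ)) ∧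
      (∀ q ∈ n, ∀ w : HeightOneSpectrum (𝓞 K), ((q : ℕ) : 𝓞 K) ∈ w.asIdeal →
        x ∈ toricLocalKer (W.baseChange K) (w.adicCompletion K) ((p ^ 1 : ℕ) : ℤ)) ∧
      (∀ ℓ' ∈ m, ∀ w : HeightOneSpectrum (𝓞 K), ((ℓ' : ℕ) : 𝓞 K) ∈ w.asIdeal → x ∈ transverseLocalKerP W K p ι ℓ' w)) := by
    intro x hx
    obtain ⟨-, h1, h2, h3, h4⟩ := (hMix m n μ x).mp hx
    exact ⟨h1, fun w _ hm hn ↦ h2 w hm hn, h3, h4⟩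
  have hrelB : ∀ x ∈ Mix (insert ℓ m) n μ, ((∀ w : InfinitePlace K, x ∈ selmerLocalKer (W.baseChange K) w.Completion ((p ^ 1 : ℕ) : ℤ)) ∧
      (∀ w : HeightOneSpectrum (𝓞 K), ((ℓ : ℕ) : 𝓞 K) ∉ w.asIdeal → (∀ ℓ' ∈ m, ((ℓ' : ℕ) : 𝓞 K) ∉ w.asIdeal) →
        (∀ q ∈ n, ((q : ℕ) : 𝓞 K) ∉ w.asIdeal) → x ∈ selmerLocalKer (W.baseChange K) (w.adicCompletion K) ((p ^ 1 : ℕ) : ℤ)) ∧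
      (∀ q ∈ n, ∀ w : HeightOneSpectrum (𝓞 K), ((q : ℕ) : 𝓞 K) ∈ w.asIdeal →
        x ∈ toricLocalKer (W.baseChange K) (w.adicCompletion K) ((p ^ 1 : ℕ) : ℤ)) ∧
      (∀ ℓ' ∈ m, ∀ w : HeightOneSpectrum (𝓞 K), ((ℓ' : ℕ) : 𝓞 K) ∈ w.asIdeal → x ∈ transverseLocalKerP W K p ι ℓ' w)) := by
    intro x hx
    obtain ⟨-, h1, h2, h3, h4⟩ := (hMix (insert ℓ m) n μ x).mp hx
    refine ⟨h1, fun w hℓw hm hn ↦ h2 w (fun ℓ'' hℓ'' ↦ ?_) hn, h3, fun ℓ' hℓ' w hw ↦ h4 ℓ' (Finset.mem_insert_of_mem hℓ') w hw⟩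
    rcases Finset.mem_insert.mp hℓ'' with rfl | hℓ''
    · exact hℓw
    · exact hm ℓ'' hℓ''
  have hiso := fun {y z : Vp W K p} (hy : ((∀ w : InfinitePlace K, y ∈ selmerLocalKer (W.baseChange K) w.Completion ((p ^ 1 : ℕ) : ℤ)) ∧
      (∀ w : HeightOneSpectrum (𝓞 K), ((ℓ : ℕ) : 𝓞 K) ∉ w.asIdeal → (∀ ℓ' ∈ m, ((ℓ' : ℕ) : 𝓞 K) ∉ w.asIdeal) →
        (∀ q ∈ n, ((q : ℕ) : 𝓞 K) ∉ w.asIdeal) → y ∈ selmerLocalKer (W.baseChange K) (w.adicCompletion K) ((p ^ 1 : ℕ) : ℤ)) ∧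
      (∀ q ∈ n, ∀ w : HeightOneSpectrum (𝓞 K), ((q : ℕ) : 𝓞 K) ∈ w.asIdeal →
        y ∈ toricLocalKer (W.baseChange K) (w.adicCompletion K) ((p ^ 1 : ℕ) : ℤ)) ∧
      (∀ ℓ' ∈ m, ∀ w : HeightOneSpectrum (𝓞 K), ((ℓ' : ℕ) : 𝓞 K) ∈ w.asIdeal → y ∈ transverseLocalKerP W K p ι ℓ' w))) (hz : ((∀ w : InfinitePlace K, z ∈ selmerLocalKer (W.baseChange K) w.Completion ((p ^ 1 : ℕ) : ℤ)) ∧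
      (∀ w : HeightOneSpectrum (𝓞 K), ((ℓ : ℕ) : 𝓞 K) ∉ w.asIdeal → (∀ ℓ' ∈ m, ((ℓ' : ℕ) : 𝓞 K) ∉ w.asIdeal) →
        (∀ q ∈ n, ((q : ℕ) : 𝓞 K) ∉ w.asIdeal) → z ∈ selmerLocalKer (W.baseChange K) (w.adicCompletion K) ((p ^ 1 : ℕ) : ℤ)) ∧
      (∀ q ∈ n, ∀ w : HeightOneSpectrum (𝓞 K), ((q : ℕ) : 𝓞 K) ∈ w.asIdeal →
        z ∈ toricLocalKer (W.baseChange K) (w.adicCompletion K) ((p ^ 1 : ℕ) : ℤ)) ∧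
      (∀ ℓ' ∈ m, ∀ w : HeightOneSpectrum (𝓞 K), ((ℓ' : ℕ) : 𝓞 K) ∈ w.asIdeal → z ∈ transverseLocalKerP W K p ι ℓ' w))) ↦
    weilCupProduct_eq_zero_at_of_mixedRelaxed W K p ι hK hp2 e hμ hadd₁ hadd₂ halt hgal m ℓ n v hv hy hz
  have hys : conjAct W c ((p ^ 1 : ℕ) : ℤ) y = sgnP μ • y := ((hMix (insert ℓ m) n μ y).mp hyB).1
  have hyT : y ∈ transverseLocalKerP W K p ι ℓ v := ((hMix (insert ℓ m) n μ y).mp hyB).2.2.2.2 ℓ (Finset.mem_insert_self ℓ m) v hv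
  -- KEY: every class of the conductor-`m` space is locally trivial at `v`
  have hkey : ∀ x ∈ Mix m n μ, x ∈ (W.baseChange K).torsionLocalKer (v.adicCompletion K) ((p ^ 1 : ℕ) : ℤ) := by
    intro x hx
    by_contra hx0
    have hxs : conjAct W c ((p ^ 1 : ℕ) : ℤ) x = sgnP μ • x := ((hMix m n μ x).mp hx).1
    have hxK : x ∈ selmerLocalKer (W.baseChange K) (v.adicCompletion K) ((p ^ 1 : ℕ) : ℤ) := ((hMix m n μ x).mp hx).2.2.1 v hmv hnv
    exact cupProduct_ne_zero_of_selmer_of_transverse_P W K p hK hp2 hsurj ι hc1 e hμ hadd₁ hadd₂ halt hnondeg hgal ℓ.2 v hv μ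
      hxs hys hxK hx0 hyT hyv (hiso (hrelA x hx) (hrelB y hyB))
  -- the two memberships differ only at `v`
  have hdict : ∀ x, x ∈ Mix m n μ ↔ (x ∈ Mix (insert ℓ m) n μ ∧ (∀ v : HeightOneSpectrum (𝓞 K), ((ℓ : ℕ) : 𝓞 K) ∈ v.asIdeal → x ∈ (W.baseChange K).torsionLocalKer (v.adicCompletion K) ((p ^ 1 : ℕ) : ℤ))) := by
    intro x
    constructor
    · intro hx
      have hx0 := hkey x hx
      obtain ⟨h0, h1, h2, h3, h4⟩ := (hMix m n μ x).mp hx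
      refine ⟨(hMix (insert ℓ m) n μ x).mpr ⟨h0, h1, fun w hm hn ↦ h2 w (fun ℓ' hℓ' ↦ hm ℓ' (Finset.mem_insert_of_mem hℓ')) hn,
        h3, fun ℓ'' hℓ'' w hw ↦ ?_⟩, fun w hw ↦ by rw [huniq w hw]; exact hx0⟩
      rcases Finset.mem_insert.mp hℓ'' with rfl | hℓ''
      · rw [huniq w hw]
        exact torsionLocalKer_le_transverseLocalKerP W K p ι _ v hx0
      · exact h4 ℓ'' hℓ'' w hw
    · rintro ⟨hx, hTx⟩
      obtain ⟨h0, h1, h2, h3, h4⟩ := (hMix (insert ℓ m) n μ x).mp hx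
      refine (hMix m n μ x).mpr ⟨h0, h1, fun w hm hn ↦ ?_, h3, fun ℓ' hℓ' w hw ↦ h4 ℓ' (Finset.mem_insert_of_mem hℓ') w hw⟩
      by_cases hℓw : ((ℓ : ℕ) : 𝓞 K) ∈ w.asIdeal
      · exact (W.baseChange K).torsionLocalKer_le_selmerLocalKer (w.adicCompletion K) _ (hTx w hℓw)
      · refine h2 w (fun ℓ'' hℓ'' ↦ ?_) hn
        rcases Finset.mem_insert.mp hℓ'' with rfl | hℓ''
        · exact hℓw
        · exact hm ℓ'' hℓ''
  refine ⟨hdict, ?_⟩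
  -- codimension exactly one: rank–nullity against the line through `loc_v y` ((IsoBound)), in the `torsionLocMap` model
  set loc := (W.baseChange K).torsionLocMap (v.adicCompletion K) ((p ^ 1 : ℕ) : ℤ) with hloc
  haveI : Module (ZMod p) (discreteH1 (Field.absoluteGaloisGroup (v.adicCompletion K))
      (AddSubgroup.torsionBy (localPoints (W.baseChange K) (v.adicCompletion K)) ((p ^ 1 : ℕ) : ℤ))) :=
    AddCommGroup.zmodModule (fun z ↦ by
      have h := zsmul_discreteH1_torsion ((p ^ 1 : ℕ) : ℤ) z
      rw [← natCast_zsmul]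
      convert h using 2
      push_cast
      ring)
  set locZ := loc.toZModLinearMap p with hlocZ
  have hlocZ_apply : ∀ x : Vp W K p, locZ x = loc x := fun _ ↦ rfl
  haveI : FiniteDimensional (ZMod p) (Mix (insert ℓ m) n μ) := hfin (insert ℓ m) n μ
  haveI : FiniteDimensional (ZMod p) (Submodule.span (ZMod p) ({loc y} : Set _)) :=
    FiniteDimensional.span_of_finite (ZMod p) (Set.finite_singleton _)
  have hfr : finrank (ZMod p) ↥(Mix (insert ℓ m) n μ ⊓ LinearMap.ker locZ) + 1 = finrank (ZMod p) (Mix (insert ℓ m) n μ) := by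
    refine ZhangInduction.finrank_inf_ker_add_one_of_line (Mix (insert ℓ m) n μ) locZ (Submodule.span (ZMod p) {loc y})
      ((finrank_span_le_card _).trans (le_of_eq (by rw [Set.toFinset_card, Set.card_singleton]))) ?_
      ⟨y, hyB, by rw [hlocZ_apply]; exact fun h ↦ hyv (AddMonoidHom.mem_ker.mpr h)⟩
    intro x hx
    have hxs : conjAct W c ((p ^ 1 : ℕ) : ℤ) x = sgnP μ • x := ((hMix (insert ℓ m) n μ x).mp hx).1
    obtain ⟨a, ha⟩ := sub_zsmul_mem_torsionLocalKer_of_isotropic_P W K p hK hp2 hsurj hc1 e hμ hadd₁ hadd₂ halt hnondeg hgal ℓ.2 v hv μ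
      hys hxs (hiso (hrelB y hyB) (hrelB y hyB)) (hiso (hrelB y hyB) (hrelB x hx)) (hiso (hrelB x hx) (hrelB y hyB))
      (hiso (hrelB x hx) (hrelB x hx)) hyv
    rw [Submodule.mem_span_singleton]
    refine ⟨(a : ZMod p), ?_⟩
    have h0 : loc (x - a • y) = 0 := AddMonoidHom.mem_ker.mp ha
    rw [map_sub, map_zsmul, sub_eq_zero] at h0
    rw [hlocZ_apply, h0, Int.cast_smul_eq_zsmul]
  have heq : Mix m n μ = Mix (insert ℓ m) n μ ⊓ LinearMap.ker locZ := by
    ext x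
    rw [Submodule.mem_inf, LinearMap.mem_ker, hlocZ_apply, hdict x]
    constructor
    · rintro ⟨hx, hTx⟩
      exact ⟨hx, AddMonoidHom.mem_ker.mp (hTx v hv)⟩
    · rintro ⟨hx, hx0⟩
      exact ⟨hx, fun w hw ↦ by rw [huniq w hw]; exact AddMonoidHom.mem_ker.mpr hx0⟩
  rw [heq]
  exact hfr

end Summit.BirchSwinnertonDyer.BirchSwinnertonDyer.Theorems.AdditiveKoly

end
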